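import Mathlib

/-!
# `CurvatureUniformityR` (stmt-QuantumFields-18154) — Negative: the registered stub `stub_sparseIslands` is FALSE as typed

Refuter (skeleton-vet `refuter-skel-stmt-QuantumFields-18154-vet-0`, 2026-08-17) negative lemma for the line
`cone-tame-window-transfer` of crux `Summit.QuantumFields.YangMills.Theses.HyperbolicRegulator.CurvatureUniformityR`
(skeleton `Cruxes/CurvatureUniformityR/Lines/cone_tame_window_transfer.lean`, sha `c2a799d8…`, stub
`ConeTameWindowTransfer.stub_sparseIslands : SparseIslandPathBound`).  The `Cruxes/…/Lines` module is not importable from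
`Theorems/`, so the stub's `def SparseIslandPathBound : Prop` body is inlined VERBATIM inside `¬ (…)` below (no `def`, nothing
posited); `¬ ConeTameWindowTransfer.SparseIslandPathBound` then follows by `exact stub_sparseIslands_false` (definitional unfolding).

**The defect.**  The island-size constant `N₀ := Δ ^ (D₀ + 1)` under-counts a wild island when the degree bound `Δ` is `≤ 1`:
`Δ = 0` gives `N₀ = 0` although a single wild vertex is an island of size `1`; `Δ = 1` gives `N₀ = 1` although a wild EDGE is an
island of size `2` (diameter `1 ≤ D₀`).  The prefactor `ε ^ (1 - N₀)` is then too small and the bound fails already for the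
trivial path / the one-edge path with all weights `1`:

* `stub_sparseIslands_false` — witness `V = Unit`, `Γ = ⊤` (no edges), `Δ = D₀ = 0`, `R = 1`, `W = univ`, `w ≡ 1`, `ε = 1/2`:
  `θ = 0`, LHS `= 1` (the trivial path at the vertex), RHS `= (1/2)^1 · 0^0 / 1 = 1/2`.
* `stub_sparseIslands_false_of_one_le_degree` — the cheap repair `1 ≤ Δ` is NOT enough: witness `V = Bool`, `Γ = ⊤` (one edge),
  `Δ = 1`, `D₀ = 1`, `R = 3`, `W = univ`, `w ≡ 1`, `ε = 1/64`: `N₀ = 1`, `θ = (1/64)^(2/3) = 1/16 < 1`, and between the two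
  endpoints LHS `= 1` (the edge), RHS `= (1/64)^0 · (1/16) / (15/16) = 1/15`.

**Repair (refuted-misstated, for the line's planner).**  Insert `2 ≤ Δ →` after the degree hypothesis (then
`|B(v, D₀)| ≤ 1 + Δ + ⋯ + Δ^{D₀} ≤ Δ^{D₀+1} = N₀` and the card's counting argument — a self-avoiding path of length `n` meets
`≤ 1 + n/R` islands and `≤ N₀` vertices of each, `≤ Δ^n` paths of length `n` — goes through); equivalently replace `N₀` by
`∑ i ∈ Finset.range (D₀ + 1), Δ ^ i`.  In the line's application `Δ` is the cell-graph degree of `S × S` (`≫ 2`), so the witnesses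
miss the repaired statement; `stub_graphCellEngine : SparseIslandPathBound → GraphCellMixingEngine` is vacuous until the repair.
[folklore]
-/

set_option autoImplicit false

namespace Summit.QuantumFields.YangMills.Theorems.CurvatureUniformityR.Negative

/-- **`stub_sparseIslands` is false as typed** (the body of `ConeTameWindowTransfer.SparseIslandPathBound`, verbatim, negated):
witness one wild vertex, no edges, `Δ = D₀ = 0`, `R = 1`, `w ≡ 1`, `ε = 1/2` — the trivial path gives `1 ≤ 1/2`. [folklore] -/
theorem stub_sparseIslands_false : ¬ (
    ∀ (V : Type) [Fintype V] [DecidableEq V] (Γ : SimpleGraph V) [DecidableRel Γ.Adj]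
      (Δ D₀ R : ℕ) (W : Finset V) (w : V → ℝ) (ε : ℝ),
      Γ.Connected →
      (∀ v, Γ.degree v ≤ Δ) →
      2 * D₀ < R →
      (∀ u ∈ W, ∀ v ∈ W, Γ.dist u v ≤ D₀ ∨ R ≤ Γ.dist u v) →
      0 < ε → ε ≤ 1 →
      (∀ v, 0 ≤ w v ∧ w v ≤ 1) → (∀ v, v ∉ W → w v ≤ ε) →
      let N₀ : ℕ := Δ ^ (D₀ + 1)
      let θ : ℝ := (Δ : ℝ) * ε ^ (1 - (N₀ : ℝ) / R)
      θ < 1 →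
      ∀ x y : V,
        ∑ n ∈ Finset.range (Fintype.card V),
            ∑ p ∈ (Γ.finsetWalkLength n x y).filter (fun p => p.IsPath),
              ∏ v ∈ p.support.toFinset, w v
          ≤ ε ^ (1 - (N₀ : ℝ)) * θ ^ Γ.dist x y / (1 - θ)) := by
  intro h
  have key := h Unit ⊤ 0 0 1 Finset.univ (fun _ => 1) (1 / 2)
    SimpleGraph.Connected.of_subsingleton
    (fun v => by simp)
    (by norm_num)
    (fun u _ v _ => Or.inl (by simp))
    (by norm_num) (by norm_num)
    (fun _ => by norm_num)
    (fun v hv => (hv (Finset.mem_univ v)).elim)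
    (by norm_num) () ()
  have hnil : (SimpleGraph.Walk.nil : (⊤ : SimpleGraph Unit).Walk () ()) ∈
      ((⊤ : SimpleGraph Unit).finsetWalkLength 0 () ()).filter (fun p => p.IsPath) := by
    simp [SimpleGraph.mem_finsetWalkLength_iff]
  have h0 : (0 : ℕ) ∈ Finset.range (Fintype.card Unit) := by simp
  have hLHS : (1 : ℝ) ≤ ∑ n ∈ Finset.range (Fintype.card Unit),
      ∑ p ∈ ((⊤ : SimpleGraph Unit).finsetWalkLength n () ()).filter (fun p => p.IsPath),
        ∏ v ∈ p.support.toFinset, (fun _ : Unit => (1 : ℝ)) v := by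
    calc (1 : ℝ) = ∏ v ∈ (SimpleGraph.Walk.nil : (⊤ : SimpleGraph Unit).Walk () ()).support.toFinset,
          (fun _ : Unit => (1 : ℝ)) v := by simp
      _ ≤ ∑ p ∈ ((⊤ : SimpleGraph Unit).finsetWalkLength 0 () ()).filter (fun p => p.IsPath),
          ∏ v ∈ p.support.toFinset, (fun _ : Unit => (1 : ℝ)) v :=
        Finset.single_le_sum (f := fun p : (⊤ : SimpleGraph Unit).Walk () () =>
          ∏ v ∈ p.support.toFinset, (fun _ : Unit => (1 : ℝ)) v) (fun _ _ => by positivity) hnil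
      _ ≤ _ := Finset.single_le_sum (f := fun n => ∑ p ∈ ((⊤ : SimpleGraph Unit).finsetWalkLength n () ()).filter
          (fun p => p.IsPath), ∏ v ∈ p.support.toFinset, (fun _ : Unit => (1 : ℝ)) v)
          (fun _ _ => by positivity) h0
  have := hLHS.trans key
  norm_num at this

/-- **The repair `1 ≤ Δ` is still false** (the stub's body with `1 ≤ Δ →` inserted after the degree hypothesis, negated):
witness one wild edge (`V = Bool`, `Γ = ⊤`), `Δ = 1`, `D₀ = 1`, `R = 3`, `w ≡ 1`, `ε = 1/64` — `θ = (1/64)^(2/3) = 1/16` and the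
edge path gives `1 ≤ 1/15`.  So the minimal repair is `2 ≤ Δ`. [folklore] -/
theorem stub_sparseIslands_false_of_one_le_degree : ¬ (
    ∀ (V : Type) [Fintype V] [DecidableEq V] (Γ : SimpleGraph V) [DecidableRel Γ.Adj]
      (Δ D₀ R : ℕ) (W : Finset V) (w : V → ℝ) (ε : ℝ),
      Γ.Connected →
      (∀ v, Γ.degree v ≤ Δ) →
      1 ≤ Δ →
      2 * D₀ < R →
      (∀ u ∈ W, ∀ v ∈ W, Γ.dist u v ≤ D₀ ∨ R ≤ Γ.dist u v) →
      0 < ε → ε ≤ 1 →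
      (∀ v, 0 ≤ w v ∧ w v ≤ 1) → (∀ v, v ∉ W → w v ≤ ε) →
      let N₀ : ℕ := Δ ^ (D₀ + 1)
      let θ : ℝ := (Δ : ℝ) * ε ^ (1 - (N₀ : ℝ) / R)
      θ < 1 →
      ∀ x y : V,
        ∑ n ∈ Finset.range (Fintype.card V),
            ∑ p ∈ (Γ.finsetWalkLength n x y).filter (fun p => p.IsPath),
              ∏ v ∈ p.support.toFinset, w v
          ≤ ε ^ (1 - (N₀ : ℝ)) * θ ^ Γ.dist x y / (1 - θ)) := by
  intro h
  have hθ : ((1 : ℕ) : ℝ) * (1 / 64 : ℝ) ^ (1 - (((1 : ℕ) ^ (1 + 1) : ℕ) : ℝ) / ((3 : ℕ) : ℝ)) < 1 := by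
    norm_num
  have hadj : (⊤ : SimpleGraph Bool).Adj false true := by simp
  have key := h Bool ⊤ 1 1 3 Finset.univ (fun _ => 1) (1 / 64)
    SimpleGraph.connected_top
    (fun v => by simp)
    le_rfl
    (by norm_num)
    (fun u _ v _ => Or.inl (by rw [SimpleGraph.dist_top]; split <;> norm_num))
    (by norm_num) (by norm_num)
    (fun _ => by norm_num)
    (fun v hv => (hv (Finset.mem_univ v)).elim)
    hθ false true
  have hcons : (SimpleGraph.Walk.cons hadj SimpleGraph.Walk.nil : (⊤ : SimpleGraph Bool).Walk false true) ∈
      ((⊤ : SimpleGraph Bool).finsetWalkLength 1 false true).filter (fun p => p.IsPath) := by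
    simp [SimpleGraph.mem_finsetWalkLength_iff]
  have h1 : (1 : ℕ) ∈ Finset.range (Fintype.card Bool) := by simp
  have hLHS : (1 : ℝ) ≤ ∑ n ∈ Finset.range (Fintype.card Bool),
      ∑ p ∈ ((⊤ : SimpleGraph Bool).finsetWalkLength n false true).filter (fun p => p.IsPath),
        ∏ v ∈ p.support.toFinset, (fun _ : Bool => (1 : ℝ)) v := by
    calc (1 : ℝ) = ∏ v ∈ (SimpleGraph.Walk.cons hadj SimpleGraph.Walk.nil :
          (⊤ : SimpleGraph Bool).Walk false true).support.toFinset, (fun _ : Bool => (1 : ℝ)) v := by simp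
      _ ≤ ∑ p ∈ ((⊤ : SimpleGraph Bool).finsetWalkLength 1 false true).filter (fun p => p.IsPath),
          ∏ v ∈ p.support.toFinset, (fun _ : Bool => (1 : ℝ)) v :=
        Finset.single_le_sum (f := fun p : (⊤ : SimpleGraph Bool).Walk false true =>
          ∏ v ∈ p.support.toFinset, (fun _ : Bool => (1 : ℝ)) v) (fun _ _ => by positivity) hcons
      _ ≤ _ := Finset.single_le_sum (f := fun n => ∑ p ∈ ((⊤ : SimpleGraph Bool).finsetWalkLength n false true).filter
          (fun p => p.IsPath), ∏ v ∈ p.support.toFinset, (fun _ : Bool => (1 : ℝ)) v)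
          (fun _ _ => by positivity) h1
  have := hLHS.trans key
  rw [SimpleGraph.dist_top_of_ne (by decide)] at this
  norm_num at this

end Summit.QuantumFields.YangMills.Theorems.CurvatureUniformityR.Negative
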